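import Summits.NavierStokesRegularity.NavierStokesRegularity.Theses.AdaptedFrequency
import Literature.Analysis.FluidPDE.AdaptedBackwardKernel
import HarnessLib.Audit

/-!
# Line `li-yau-type1-curvature` — skeleton for the crux `AdaptedFrequency.AdaptedKernelExists`
(crux item stmt-NavierStokesRegularity-2956, rank 4; route `route-NavierStokesRegularity-AdaptedFrequency`)

Crux (FIXED, by name, `Summit.NavierStokesRegularity.NavierStokesRegularity.Theses.AdaptedFrequency.AdaptedKernelExists`):
for every finite-energy classical solution `(u, p)` of unforced NS on `ℝ³ × [0,T)` from a rapidly decaying datum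
with the Type-I rate `‖u(t)‖∞ ≤ C (T−t)^{-1/2}` near `T`, and every `x₀ ∈ ℝ³`, there are `t₀ ∈ [0,T)` and a
FLOW-ADAPTED BACKWARD KERNEL `G` on `[t₀,T)` ending at `δ_{x₀}` (C², `G > 0`, `∂ₜG + u·∇G + νΔG = 0`, `∫G = 1`,
concentration at `x₀`) which is TWO-SIDED GAUSSIAN-COMPARABLE at scale `√(T−t)` about `x₀` with one set of
constants down to the singular time.

Idea (card `Ideas/li-yau-type1-curvature.md`, ideator 1 idea 3; triage r1-k1: pass, two sharpenings): the Li–Yau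
maximum principle for `f = log G` and the time-reversed operator `L_t = νΔ + u(t)·∇` (Bakry–Émery
`Γ₂(f) = ν²‖∇²f‖² − ν ∇ˢu(∇f,∇f)`: the antisymmetric part of `∇u` drops out) converts the TYPE-I PARABOLIC
REGULARITY of `u` — `‖u‖ ≤ C(T−t)^{-1/2}`, `‖∇u‖ ≤ C′(T−t)^{-1}`, `‖∂ₜu‖ ≤ C″(T−t)^{-3/2}`, a consequence of Type I
for (restarted) bounded mild solutions (KNSS 2009 Prop. 4.1 with (4.6), PROVED in the tree as
`Literature.Analysis.FluidPDE.KNSS2009_prop41_mild_holds`) — into a scale-critical lower curvature bound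
`CD(−k/(T−t), 3(1+δ))`, `k = 2C²/(3δν) + 2C′` (+ the `[∂ₜ, L]` term `αC″`), and Li–Yau's estimate RESTARTED on each
block `[t, (t+T)/2]` gives the differential Harnack inequality `ν‖∇log G‖² + α ∂ₜ log G ≤ K/(T−t)` with
`K = K(ν, C, C′, C″, α)` and NO accumulation toward `T` (STUB 2, the lever). Integrated along one space-time
segment it is a parabolic Harnack inequality at scale `√(T−t)` which, with the (elementary) tightness of `G(t)`
at scale `√(T−t)`, is the Gaussian LOWER bound in one stroke (STUB 3). The UPPER bound is the divergence-free
a-priori bound of Carlen–Loss / Maekawa (exponential moments + local maximum principle; STUB 4). Existence: on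
truncated windows `[t₃, T′]`, `T′ < T`, the drift is smooth and bounded with bounded gradient and time derivative, so
the classical fundamental solution exists (Friedman 1964, Ch. 1, Thms 10–11, (6.12); STUB 5); since every Type-I
bound relative to `T` is a Type-I bound relative to `T′ < T` with the SAME constant, STUBS 2–4 give two-sided bounds
for the truncated kernels with constants independent of `T′`, and a compactness passage `T′ ↑ T` (STUB 6) produces
the kernel of the crux. STUB 1 is the Navier–Stokes input (Type I ⇒ the derivative package), the only place where
`u` solving NS is used beyond `‖u‖ ≤ C/√(T−t)`.

## Stubs (6, registered; all stated over existing Literature / route declarations only — no local definitions)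
* `stub_typeOnePackage`     — S1, NS Type-I parabolic regularity (size L): Type-I classical Leray–Hopf ⇒ on some
  `[t₁, T)`: `‖u‖ ≤ C/√(T−t)`, `‖∇u‖ ≤ C′/(T−t)`, `‖∂ₜu‖ ≤ C″/(T−t)^{3/2}`.
* `stub_liYauHarnack`       — S2, THE LEVER (size L–XL, hardest): the a-priori differential Harnack inequality for
  smooth adapted kernels of smooth drifts carrying the Type-I package; `K` depends on `(ν, C, C′, C″, α)` only.
* `stub_harnackLowerBound`  — S3 (size M): Harnack inequality + `div b = 0` + `‖b‖ ≤ C/√(T−t)` + kernel axioms ⇒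
  Gaussian lower bound with constants `(ν, C, K, α)`.
* `stub_gaussianUpperBound` — S4 (size L): `div b = 0` + `‖b‖ ≤ C/√(T−t)` + kernel axioms + a QUALITATIVE Gaussian
  upper envelope ⇒ Gaussian upper bound with constants `(ν, C)` (Carlen–Loss 1995 Thm 3 / Maekawa 2008 Thm 1.1,
  a-priori form).
* `stub_truncatedKernel`    — S5 (classical; size XL in Lean): adapted kernel of a smooth bounded divergence-free
  drift with bounded `∇b`, `∂ₜb` on a truncated window, smooth, with a qualitative Gaussian upper envelope.
* `stub_limitKernel`        — S6 (size L): kernels on `[t₃, T′)` for all `T′ ∈ (t₀, T)` with UNIFORM two-sided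
  Gaussian bounds ⇒ a kernel on `[t₀, T)` (`t₃ < t₀`) with the same bounds, ending at `δ_{x₀}` at time `T`.
* `linearKernel_of_stubs : S2 → S3 → S4 → S5 → S6 → C⁺⁺` — the kernel-checked, sorry-free assembly of the
  TRANSFER TARGET `C⁺⁺` (= the card's `LinearTypeIDriftKernel` with the two extra derivative hypotheses: two-sided
  bounds, constants depending on `(ν, C, C′, C″)` only, for the adapted kernel of ANY smooth divergence-free drift
  carrying the Type-I package; window placement `t₃ = (t₁+t₀)/2`, `α = 2`, monotonicity of the Type-I package
  under `T ↦ T′ ≤ T`); `adaptedKernelExists_of_linear : S1 → C⁺⁺ → (crux body)` — the transfer, sorry-free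
  (`t₀ = (t₁+T)/2`, `isAdaptedBackwardKernel_iff`); and the audit-shaped skeleton theorem
  `AdaptedKernelExists_of : AdaptedKernelExists` applying both to the six stubs BY NAME.

## Disproof used
No `Disproof.lean` exists for this crux at planning time (`ledger crux cat stmt-NavierStokesRegularity-2956
Disproof.lean` → "no crux workfile", 2026-08-16T00:2xZ); no `Theorems/AdaptedKernelExists/Negative/` lemma has
landed; `ledger negatives --problem NavierStokesRegularity` lists one unrelated refuted statement (route Blowup).
Nothing to honour or import; the stub set is checked against the recorded failure "dyadic Aronson chaining
(constants multiply)" (route-review note on the item): no stub composes Harnack constants across blocks — S2 is an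
estimate AT each time from the adjacent half-block, S3 pays one Harnack factor `2^{K/α}` per point, S6 passes to
the limit with constants that do not depend on `T′`.
-/

noncomputable section

open Set MeasureTheory Filter Topology
open Literature.Analysis.FluidPDE

namespace Summit.NavierStokesRegularity.NavierStokesRegularity.Cruxes.AdaptedKernelExists.LiYauType1Curvature

set_option linter.unusedVariables false
set_option linter.dupNamespace false

/-! ## Stub 1 — the Navier–Stokes input: Type I ⇒ the Type-I derivative package -/

/-- **STUB 1 (`stub_typeOnePackage`; NS Type-I parabolic regularity; size L).** For a classical solution of
unforced NS on `ℝ³ × [0,T)` (`0 < ν`) which is Leray–Hopf from a rapidly decaying datum and blows up at most at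
the Type-I rate at `T`, there are `t₁ ∈ [0,T)` and constants `C, C′, C″ ≥ 0` with, for all `t ∈ [t₁,T)` and all `x`:
`‖u(t,x)‖ ≤ C/√(T−t)`, `‖∇u(t,x)‖ ≤ C′/(T−t)` (operator norm of the Fréchet derivative) and
`‖∂ₜu(t,x)‖ ≤ C″/(T−t)^{3/2}` (one-sided time derivative within `[0,T)`, the route's convention).
Mechanism: Type I gives `‖u‖ ≤ C/√(T−t)` on some `(t₁′, T)`; restart at `s = t − ℓ`, `ℓ = ε(1)(T−t)/(2C²)`, with
`N = C/√(T−t) ≥ sup_{[s,t]} ‖u‖`: KNSS 2009 Prop. 4.1 with (4.6) (tree: `KNSS2009_prop41_mild_holds`, windows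
`N²(t−s) < ε(k)`, `l ≤ 1`) gives `‖∇u(t)‖ ≤ C(1)N/√ℓ = C(1)√(2/ε(1)) C²/(T−t)` and the `l = 1` clause the
time-Lipschitz bound `‖∂ₜu(t)‖ ≤ 2C(0)C³/(ε(0)(T−t)^{3/2})`; the bookkeeping that `u` is (restarted) MILD on the
windows uses Leray–Hopf + boundedness (weak–strong uniqueness / the tree bridge
`IsClassicalNSSolutionOn.isMildNSSolutionOn_holds`, whose pressure-boundedness hypothesis is the triage's
sharpening (1); alternatively the bounded-WEAK window fact `KNSS2009_regularity_boundedWeak_window`, no pressure).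
Why plausibly true: it is the standard Type-I regularity package (KNSS 2009 §6 proof of Thm 6.2; the natural
hypothesis (4) of Thm 1.1 of arXiv:2511.09556).
[cite: KochNadirashviliSereginSverak2009, Prop. 4.1 with (4.6), (4.10)–(4.11)] -/
theorem stub_typeOnePackage :
    ∀ (ν T : ℝ), 0 < ν → 0 < T →
      ∀ (u : ℝ → EuclideanSpace ℝ (Fin 3) → EuclideanSpace ℝ (Fin 3))
        (p : ℝ → EuclideanSpace ℝ (Fin 3) → ℝ),
        IsClassicalNSSolutionOn (Ico 0 T) ν 0 u p → IsLerayHopfOn T ν 0 (u 0) u →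
        HasRapidSpatialDecay (u 0) → IsTypeIBlowup u T →
        ∃ t₁ ∈ Ico 0 T, ∃ C C' C'' : ℝ, 0 ≤ C ∧ 0 ≤ C' ∧ 0 ≤ C'' ∧
          ∀ t ∈ Ico t₁ T, ∀ x,
            ‖u t x‖ ≤ C / Real.sqrt (T - t) ∧
            ‖fderiv ℝ (u t) x‖ ≤ C' / (T - t) ∧
            ‖timeDerivWithin (Ico 0 T) u t x‖ ≤ C'' / (T - t) ^ ((3:ℝ) / 2) := by
  sorry

/-! ## Stub 2 — THE LEVER: the Type-I differential Harnack inequality (Li–Yau / Bakry–Qian) -/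

/-- **STUB 2 (`stub_liYauHarnack`; the load-bearing lever; size L–XL; hardest).** For `0 < ν`, `C, C′, C″ ≥ 0`,
`α > 1` there is `K = K(ν, C, C′, C″, α) ≥ 0` such that: for every window `[t₀, T)`, every drift `b` jointly smooth
on `[t₀,T) × ℝ³` carrying the TYPE-I PACKAGE relative to `T` (`‖b‖ ≤ C/√(T−t)`, `‖∇b‖ ≤ C′/(T−t)`,
`‖∂ₜb‖ ≤ C″/(T−t)^{3/2}`), every pole `x₀` and every jointly smooth flow-adapted backward kernel `G` of `b` on
`[t₀, T)` ending at `δ_{x₀}` at time `T`, the logarithm `f = log G` satisfies, at every `(t, x) ∈ [t₀,T) × ℝ³`,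
`ν ‖∇f(t,x)‖² + α ∂ₜ f(t,x) ≤ K/(T − t)`.
Mechanism (ν = 1, reversed time `τ = T − t`, forward operator `𝓛 = Δ + B·∇ − ∂_τ`, `F = τ_el(‖∇f‖² − α f_τ)` with
`τ_el` the time elapsed since the start `(t+T)/2` of the block `[t, (t+T)/2]`): Bakry–Émery
`Γ₂(f) = ‖∇²f‖² − ∇ˢB(∇f,∇f)`, `‖∇²f‖² ≥ (Δf)²/3`, `Δf = 𝓛f + f_τ − B·∇f` give `CD(−k, 3(1+δ))` on the block with
`k = 2C²/(3δν) + 2C′` times `(T−t)^{-1}`; the time dependence of `B` adds `α τ_el (∂_τB)·∇f = O(C″ √W)`,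
`W = τ_el‖∇f‖²`; at a maximum of (a cut-off of) `F` the scale-free bookkeeping
`c[((α−1)/α)W + F/α]² ≤ F + (2C′ + 2C²/(3δν))W + αC″√W` closes: `F ≤ K`. Li–Yau is LOCAL in time (the block needs
nothing from earlier blocks: the `1/τ_el` term is `2/(T−t)` at the block's end) and GLOBAL in space (cut-off
argument on flat complete `ℝ³`; no growth condition on `G`, positivity suffices), so the tower of blocks toward `T`
is never traversed. Calibration: free kernel `(1−α)‖x−x₀‖²/(4ν(T−t)²) + 3α/(2(T−t)) ≤ 3α/(2(T−t))`; drifting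
Gaussian `b = C e/√(T−t)`: `K = 3α/2 + α²C²/(4ν(α−1))` (the `C²/ν` dependence is forced). No Gaussian-comparability
hypothesis (triage sharpening (2)): the statement is a genuine a-priori estimate.
Why it might fail: only if the cut-off argument does not close for a non-gradient, time-dependent drift whose C¹
size is critical — the `Γ₂` computation above says the antisymmetric part never enters (one-line check).
[cite: LiYau1986, Thm 1.2 (p.158), Thm 1.3 (p.162)] [cite: BakryQian1999, Thm 1 and §5 p.175 (L_B = Δ + B, Ric − ∇ˢB − B⊗B/(m−n) ≥ −K)] [cite: Qian1995] [cite: KochNadirashviliSereginSverak2009, Prop. 4.1] -/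
theorem stub_liYauHarnack :
    ∀ (ν C C' C'' α : ℝ), 0 < ν → 0 ≤ C → 0 ≤ C' → 0 ≤ C'' → 1 < α → ∃ K : ℝ, 0 ≤ K ∧
      ∀ (t₀ T : ℝ) (b : ℝ → EuclideanSpace ℝ (Fin 3) → EuclideanSpace ℝ (Fin 3))
        (x₀ : EuclideanSpace ℝ (Fin 3)) (G : ℝ → EuclideanSpace ℝ (Fin 3) → ℝ), t₀ < T →
        IsSmoothSpaceTimeOn (Ico t₀ T) b →
        (∀ t ∈ Ico t₀ T, ∀ x, ‖b t x‖ ≤ C / Real.sqrt (T - t)) →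
        (∀ t ∈ Ico t₀ T, ∀ x, ‖fderiv ℝ (b t) x‖ ≤ C' / (T - t)) →
        (∀ t ∈ Ico t₀ T, ∀ x, ‖timeDerivWithin (Ico t₀ T) b t x‖ ≤ C'' / (T - t) ^ ((3:ℝ) / 2)) →
        IsAdaptedBackwardKernel ν b (Ico t₀ T) T x₀ G → IsSmoothSpaceTimeOn (Ico t₀ T) G →
        ∀ t ∈ Ico t₀ T, ∀ x,
          ν * ‖gradient (fun y => Real.log (G t y)) x‖ ^ 2 +
              α * timeDerivWithin (Ico t₀ T) (fun s y => Real.log (G s y)) t x ≤ K / (T - t) := by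
  sorry

/-! ## Stub 3 — Harnack by integration + tightness at scale ⇒ the Gaussian lower bound -/

/-- **STUB 3 (`stub_harnackLowerBound`; size M).** For `0 < ν`, `C ≥ 0`, `K ≥ 0`, `α > 1` there are
`c₁, c₂ > 0` depending only on these such that: for every window `[t₀,T)`, every jointly smooth divergence-free
drift `b` with `‖b(t)‖∞ ≤ C/√(T−t)`, every pole `x₀`, and every flow-adapted backward kernel `G` of `b` on `[t₀,T)`
ending at `δ_{x₀}` at `T` whose logarithm satisfies the differential Harnack inequality of STUB 2 with constant `K`,
`G(t,x) ≥ c₁ (T−t)^{-3/2} exp(−‖x−x₀‖²/(c₂(T−t)))` on `[t₀,T) × ℝ³`.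
Mechanism: (i) integrate the inequality along the segment from `(t′,x′)`, `t′ = (t+T)/2`, to `(t,x)`:
`log G(t,x) ≥ log G(t′,x′) − α‖x−x′‖²/(2ν(T−t)) − (K/α) log 2`; (ii) TIGHTNESS AT SCALE from the kernel axioms
alone: for a compactly supported cut-off `φ` (`= 1` on `B(x₀,ρ)`, `0` off `B(x₀,2ρ)`),
`d/ds ∫φG(s) = ∫G(b·∇φ − νΔφ)` (adjoint equation, `div b = 0`, no boundary terms), so with `∫G = 1`, `G > 0` and
the concentration clause, `1 − ∫φG(t′) ≤ 2cC√(T−t′)/ρ + νc(T−t′)/ρ²  ≤ 1/2` for `ρ = R√(T−t′)`, `R = R(ν,C)`;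
hence some `x′ ∈ B(x₀, 2R√(T−t′))` has `G(t′,x′) ≥ c (T−t′)^{-3/2}`; (iii) `‖x−x′‖² ≤ 2‖x−x₀‖² + 8R²(T−t′)`.
No moment bounds, no Moser iteration, no chain of Harnack balls. Why plausibly true: every step is calculus on the
five kernel clauses; the only input beyond them is the pointwise inequality of STUB 2.
[cite: LiYau1986, Thm 2.1 (p.166: Harnack by integrating the gradient estimate)] -/
theorem stub_harnackLowerBound :
    ∀ (ν C K α : ℝ), 0 < ν → 0 ≤ C → 0 ≤ K → 1 < α → ∃ c₁ c₂ : ℝ, 0 < c₁ ∧ 0 < c₂ ∧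
      ∀ (t₀ T : ℝ) (b : ℝ → EuclideanSpace ℝ (Fin 3) → EuclideanSpace ℝ (Fin 3))
        (x₀ : EuclideanSpace ℝ (Fin 3)) (G : ℝ → EuclideanSpace ℝ (Fin 3) → ℝ), t₀ < T →
        IsSmoothSpaceTimeOn (Ico t₀ T) b →
        (∀ t ∈ Ico t₀ T, VectorCalculus.IsDivFree (b t)) →
        (∀ t ∈ Ico t₀ T, ∀ x, ‖b t x‖ ≤ C / Real.sqrt (T - t)) →
        IsAdaptedBackwardKernel ν b (Ico t₀ T) T x₀ G →
        (∀ t ∈ Ico t₀ T, ∀ x,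
          ν * ‖gradient (fun y => Real.log (G t y)) x‖ ^ 2 +
              α * timeDerivWithin (Ico t₀ T) (fun s y => Real.log (G s y)) t x ≤ K / (T - t)) →
        ∀ t ∈ Ico t₀ T, ∀ x,
          c₁ * (T - t) ^ (-(3:ℝ) / 2) * Real.exp (-(‖x - x₀‖ ^ 2) / (c₂ * (T - t))) ≤ G t x := by
  sorry

/-! ## Stub 4 — the divergence-free a-priori Gaussian upper bound (Carlen–Loss / Maekawa) -/

/-- **STUB 4 (`stub_gaussianUpperBound`; size L).** For `0 < ν`, `C ≥ 0` there are `C₁, C₂ > 0` depending only on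
`(ν, C)` such that: for every window `[t₀,T)`, every jointly smooth DIVERGENCE-FREE drift `b` with
`‖b(t)‖∞ ≤ C/√(T−t)`, every pole `x₀` and every flow-adapted backward kernel `G` of `b` on `[t₀,T)` ending at
`δ_{x₀}` at `T` which admits SOME Gaussian upper envelope `G ≤ A (T−t)^{-3/2} e^{−‖x−x₀‖²/(a(T−t))}` (qualitative:
`A`, `a` arbitrary — this only licenses the integrations by parts and the limit `s ↑ T` below; the conclusion's
constants do not depend on them, so the statement is not circular), one has
`G(t,x) ≤ C₁ (T−t)^{-3/2} e^{−‖x−x₀‖²/(C₂(T−t))}` on `[t₀,T) × ℝ³`.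
Mechanism (a-priori Carlen–Loss 1995 Thm 3 = Maekawa 2008 Thm 1.1 upper half, after `s = ν(T−t)`): exponential
moments `m(t) = ∫ e^{λ⟨e, x−x₀⟩} G(t,x) dx` obey `d/dt m ≥ −(λC/√(T−t) + νλ²) m` (adjoint equation, `div b = 0`;
differentiation justified by the envelope) and `m(s) → 1` as `s ↑ T` (envelope + concentration), whence
`∫ e^{μ⟨e,(x−x₀)/√(T−t)⟩} G(t,x) dx ≤ e^{2μC + νμ²}`: Gaussian TAILS of the mass at scale `√(T−t)` in every direction;
then mass → pointwise by the local maximum principle on the future cylinder `[t, t + (T−t)/4] × B(x, √(T−t)/2)`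
(radius × drift ≤ C/√3: tree `Lieberman1996_local_max_holds`, PROVED), which also gives the on-diagonal cap
`G ≤ c(ν,C)(T−t)^{-3/2}` without Carlen–Loss. (Alternative inside the stub: Nash `L¹→L∞` + Davies tilt.)
Why plausibly true: it is a printed theorem (time-critical class (C) of Maekawa) in a-priori form; the pathwise
displacement heuristic `∫ₜᵀ C(T−s)^{-1/2} ds = 2C√(T−t)` explains the constants `e^{O(C²/ν)}`.
[cite: CarlenLoss1995, Thm 3] [cite: Maekawa2008, Thm 1.1] [cite: Lieberman1996, Thm 6.17] -/
theorem stub_gaussianUpperBound :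
    ∀ (ν C : ℝ), 0 < ν → 0 ≤ C → ∃ C₁ C₂ : ℝ, 0 < C₁ ∧ 0 < C₂ ∧
      ∀ (t₀ T : ℝ) (b : ℝ → EuclideanSpace ℝ (Fin 3) → EuclideanSpace ℝ (Fin 3))
        (x₀ : EuclideanSpace ℝ (Fin 3)) (G : ℝ → EuclideanSpace ℝ (Fin 3) → ℝ), t₀ < T →
        IsSmoothSpaceTimeOn (Ico t₀ T) b →
        (∀ t ∈ Ico t₀ T, VectorCalculus.IsDivFree (b t)) →
        (∀ t ∈ Ico t₀ T, ∀ x, ‖b t x‖ ≤ C / Real.sqrt (T - t)) →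
        IsAdaptedBackwardKernel ν b (Ico t₀ T) T x₀ G →
        (∃ A a : ℝ, 0 < a ∧ ∀ t ∈ Ico t₀ T, ∀ x,
          G t x ≤ A * (T - t) ^ (-(3:ℝ) / 2) * Real.exp (-(‖x - x₀‖ ^ 2) / (a * (T - t)))) →
        ∀ t ∈ Ico t₀ T, ∀ x,
          G t x ≤ C₁ * (T - t) ^ (-(3:ℝ) / 2) * Real.exp (-(‖x - x₀‖ ^ 2) / (C₂ * (T - t))) := by
  sorry

/-! ## Stub 5 — classical existence on truncated windows (Friedman) -/

/-- **STUB 5 (`stub_truncatedKernel`; classical theorem, un-vendored; size XL in Lean).** Let `0 < ν`,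
`t₂ < t₃ < T′ < T`, and let the drift `b` be jointly smooth and divergence free on `(t₂, T) × ℝ³` with `b`, `∇b`,
`∂ₜb` bounded on `(t₂, T′] × ℝ³`. Then for every pole `x₀` there is a flow-adapted backward kernel `G` of `b` on
`[t₃, T′)` ending at `δ_{x₀}` at time `T′`, jointly smooth on `[t₃,T′) × ℝ³`, admitting a (qualitative) Gaussian
upper envelope `G ≤ A (T′−t)^{-3/2} e^{−‖x−x₀‖²/(a(T′−t))}`.
Mechanism: after `τ = T′ − t` the adjoint equation is the FORWARD non-divergence equation
`∂_τ G = νΔG + b̃·∇G`, `b̃(τ) = b(T′−τ)`, with bounded coefficients uniformly Hölder in `(x, τ)` (from the bounds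
on `∇b`, `∂ₜb`): Friedman's parametrix gives the fundamental solution `Γ̃(x,τ; ξ,0)` with the Gaussian bounds
(6.12) for `Γ̃`, `∇Γ̃`; `G(t,x) := Γ̃(x, T′−t; x₀, 0)` is positive (strong maximum principle), has unit mass
(`d/dτ ∫G = −∫G div b̃ = 0`, integration by parts licensed by (6.12)), concentrates at `x₀` (Gaussian bound + unit
mass), and is smooth for `τ > 0` because the coefficients are (interior regularity; the window `(t₂,T)` is open
below `t₃`, so smoothness holds up to `t₃`). The `T′ < T` case flagged by the grounder (Aronson/Friedman for bounded
smooth drift) as the natural first split of the crux.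
[cite: Friedman1964, Ch. 1 Thms 10–11, (6.12), §8 Thm 15] [cite: Aronson1967, Thm 1] -/
theorem stub_truncatedKernel :
    ∀ (ν t₂ t₃ T' T : ℝ) (b : ℝ → EuclideanSpace ℝ (Fin 3) → EuclideanSpace ℝ (Fin 3))
      (x₀ : EuclideanSpace ℝ (Fin 3)), 0 < ν → t₂ < t₃ → t₃ < T' → T' < T →
      IsSmoothSpaceTimeOn (Ioo t₂ T) b →
      (∀ t ∈ Ioo t₂ T, VectorCalculus.IsDivFree (b t)) →
      (∃ B : ℝ, ∀ t ∈ Ioo t₂ T, t ≤ T' → ∀ x, ‖b t x‖ ≤ B ∧ ‖fderiv ℝ (b t) x‖ ≤ B ∧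
          ‖timeDerivWithin (Ioo t₂ T) b t x‖ ≤ B) →
      ∃ G : ℝ → EuclideanSpace ℝ (Fin 3) → ℝ,
        IsAdaptedBackwardKernel ν b (Ico t₃ T') T' x₀ G ∧ IsSmoothSpaceTimeOn (Ico t₃ T') G ∧
        ∃ A a : ℝ, 0 < a ∧ ∀ t ∈ Ico t₃ T', ∀ x,
          G t x ≤ A * (T' - t) ^ (-(3:ℝ) / 2) * Real.exp (-(‖x - x₀‖ ^ 2) / (a * (T' - t))) := by
  sorry

/-! ## Stub 6 — passage to the limit `T′ ↑ T` with uniform two-sided bounds -/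

/-- **STUB 6 (`stub_limitKernel`; size L).** Let `0 < ν`, `t₃ < t₀ < T`, `b` jointly smooth on `(t₃, T) × ℝ³`,
and `c₁, c₂, C₁, C₂ > 0`. Suppose that for every `T′ ∈ (t₀, T)` there is a jointly smooth flow-adapted backward
kernel `G′` of `b` on `[t₃, T′)` ending at `δ_{x₀}` at `T′`, two-sided Gaussian-comparable about `(T′, x₀)` with the
constants `(c₁, c₂, C₁, C₂)` (UNIFORM in `T′`). Then there is a flow-adapted backward kernel `G` of `b` on `[t₀, T)`
ending at `δ_{x₀}` at `T`, two-sided Gaussian-comparable about `(T, x₀)` with the same constants.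
Mechanism: take `T′ₖ ↑ T`; on every compact part of `(t₃, T) × ℝ³` the kernels are eventually defined and
uniformly bounded (upper bound, `T′ₖ − t ≥ (T−t)/2`), and solve one linear parabolic equation with smooth
coefficients, so interior (future-cylinder) parabolic estimates give local uniform bounds on all derivatives;
Arzelà–Ascoli and a diagonal argument give `Gₖ → G` in `C^∞_loc((t₃,T) × ℝ³)`; `G` solves the adjoint equation
(one-sided derivative at `t₀` = two-sided, since `t₃ < t₀`), is positive (uniform lower bound), the two-sided
bounds pass to the pointwise limit with the same constants, `∫G(t) = 1` by dominated convergence (uniform Gaussian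
domination), and concentration at `x₀` as `t ↑ T` follows from the upper bound + unit mass alone (triage remark).
[cite: Friedman1964, Ch. 3 (interior Schauder estimates)] [cite: LadyzhenskayaSolonnikovUraltseva1968, Ch. IV §10] -/
theorem stub_limitKernel :
    ∀ (ν t₃ t₀ T : ℝ) (b : ℝ → EuclideanSpace ℝ (Fin 3) → EuclideanSpace ℝ (Fin 3))
      (x₀ : EuclideanSpace ℝ (Fin 3)) (c₁ c₂ C₁ C₂ : ℝ), 0 < ν → t₃ < t₀ → t₀ < T →
      0 < c₁ → 0 < c₂ → 0 < C₁ → 0 < C₂ →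
      IsSmoothSpaceTimeOn (Ioo t₃ T) b →
      (∀ T' ∈ Ioo t₀ T, ∃ G' : ℝ → EuclideanSpace ℝ (Fin 3) → ℝ,
        IsAdaptedBackwardKernel ν b (Ico t₃ T') T' x₀ G' ∧ IsSmoothSpaceTimeOn (Ico t₃ T') G' ∧
        ∀ t ∈ Ico t₃ T', ∀ x,
          c₁ * (T' - t) ^ (-(3:ℝ) / 2) * Real.exp (-(‖x - x₀‖ ^ 2) / (c₂ * (T' - t))) ≤ G' t x ∧
          G' t x ≤ C₁ * (T' - t) ^ (-(3:ℝ) / 2) * Real.exp (-(‖x - x₀‖ ^ 2) / (C₂ * (T' - t)))) →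
      ∃ G : ℝ → EuclideanSpace ℝ (Fin 3) → ℝ,
        IsAdaptedBackwardKernel ν b (Ico t₀ T) T x₀ G ∧
        ∀ t ∈ Ico t₀ T, ∀ x,
          c₁ * (T - t) ^ (-(3:ℝ) / 2) * Real.exp (-(‖x - x₀‖ ^ 2) / (c₂ * (T - t))) ≤ G t x ∧
          G t x ≤ C₁ * (T - t) ^ (-(3:ℝ) / 2) * Real.exp (-(‖x - x₀‖ ^ 2) / (C₂ * (T - t))) := by
  sorry

/-! ## The composition (sorry-free) -/

/-- Monotonicity of the Type-I sup bound under lowering the pole time: `C/√(T−t) ≤ C/√(T′−t)` for `t < T′ ≤ T`,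
`0 ≤ C`. -/
theorem typeI_sup_mono {C T T' t : ℝ} (hC : 0 ≤ C) (ht : t < T') (hT' : T' ≤ T) :
    C / Real.sqrt (T - t) ≤ C / Real.sqrt (T' - t) :=
  div_le_div_of_nonneg_left hC (Real.sqrt_pos.2 (sub_pos.2 ht))
    (Real.sqrt_le_sqrt (by linarith))

/-- Monotonicity of the Type-I gradient bound: `C′/(T−t) ≤ C′/(T′−t)` for `t < T′ ≤ T`, `0 ≤ C′`. -/
theorem typeI_grad_mono {C T T' t : ℝ} (hC : 0 ≤ C) (ht : t < T') (hT' : T' ≤ T) :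
    C / (T - t) ≤ C / (T' - t) :=
  div_le_div_of_nonneg_left hC (sub_pos.2 ht) (by linarith)

/-- Monotonicity of the Type-I time-derivative bound: `C″/(T−t)^{3/2} ≤ C″/(T′−t)^{3/2}` for `t < T′ ≤ T`,
`0 ≤ C″`. -/
theorem typeI_time_mono {C T T' t : ℝ} (hC : 0 ≤ C) (ht : t < T') (hT' : T' ≤ T) :
    C / (T - t) ^ ((3:ℝ) / 2) ≤ C / (T' - t) ^ ((3:ℝ) / 2) :=
  div_le_div_of_nonneg_left hC (Real.rpow_pos_of_pos (sub_pos.2 ht) _)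
    (Real.rpow_le_rpow (sub_pos.2 ht).le (by linarith) (by norm_num))

/-- **The transfer target `C⁺⁺` from the five LINEAR stubs (sorry-free).** `C⁺⁺` (the card's `LinearTypeIDriftKernel`
with the two extra derivative hypotheses) says: for `0 < ν` and `C, C′, C″ ≥ 0` there are `c₁, c₂, C₁, C₂ > 0` such
that for every divergence-free drift `b`, jointly smooth on `(t₁, T) × ℝ³` and carrying the Type-I package
(`‖b‖ ≤ C/√(T−t)`, `‖∇b‖ ≤ C′/(T−t)`, `‖∂ₜb‖ ≤ C″/(T−t)^{3/2}`) there, every pole `x₀` and every `t₀ ∈ (t₁, T)`,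
an adapted kernel of `b` on `[t₀, T)` ending at `δ_{x₀}` at `T` exists and is two-sided Gaussian-comparable with
these constants. Proof: `α = 2`; `t₃ = (t₁+t₀)/2`; for `T′ ∈ (t₀,T)` STUB 5 gives the truncated kernel on
`[t₃,T′)`, every Type-I bound relative to `T` is one relative to `T′` with the same constant, so STUB 2 gives the
Harnack inequality and STUBS 3–4 the two-sided bounds with constants independent of `T′`; STUB 6 passes to the limit. -/
theorem linearKernel_of_stubs
    (h2 : ∀ (ν C C' C'' α : ℝ), 0 < ν → 0 ≤ C → 0 ≤ C' → 0 ≤ C'' → 1 < α → ∃ K : ℝ, 0 ≤ K ∧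
      ∀ (t₀ T : ℝ) (b : ℝ → EuclideanSpace ℝ (Fin 3) → EuclideanSpace ℝ (Fin 3))
        (x₀ : EuclideanSpace ℝ (Fin 3)) (G : ℝ → EuclideanSpace ℝ (Fin 3) → ℝ), t₀ < T →
        IsSmoothSpaceTimeOn (Ico t₀ T) b →
        (∀ t ∈ Ico t₀ T, ∀ x, ‖b t x‖ ≤ C / Real.sqrt (T - t)) →
        (∀ t ∈ Ico t₀ T, ∀ x, ‖fderiv ℝ (b t) x‖ ≤ C' / (T - t)) →
        (∀ t ∈ Ico t₀ T, ∀ x, ‖timeDerivWithin (Ico t₀ T) b t x‖ ≤ C'' / (T - t) ^ ((3:ℝ) / 2)) →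
        IsAdaptedBackwardKernel ν b (Ico t₀ T) T x₀ G → IsSmoothSpaceTimeOn (Ico t₀ T) G →
        ∀ t ∈ Ico t₀ T, ∀ x,
          ν * ‖gradient (fun y => Real.log (G t y)) x‖ ^ 2 +
              α * timeDerivWithin (Ico t₀ T) (fun s y => Real.log (G s y)) t x ≤ K / (T - t))
    (h3 : ∀ (ν C K α : ℝ), 0 < ν → 0 ≤ C → 0 ≤ K → 1 < α → ∃ c₁ c₂ : ℝ, 0 < c₁ ∧ 0 < c₂ ∧
      ∀ (t₀ T : ℝ) (b : ℝ → EuclideanSpace ℝ (Fin 3) → EuclideanSpace ℝ (Fin 3))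
        (x₀ : EuclideanSpace ℝ (Fin 3)) (G : ℝ → EuclideanSpace ℝ (Fin 3) → ℝ), t₀ < T →
        IsSmoothSpaceTimeOn (Ico t₀ T) b →
        (∀ t ∈ Ico t₀ T, VectorCalculus.IsDivFree (b t)) →
        (∀ t ∈ Ico t₀ T, ∀ x, ‖b t x‖ ≤ C / Real.sqrt (T - t)) →
        IsAdaptedBackwardKernel ν b (Ico t₀ T) T x₀ G →
        (∀ t ∈ Ico t₀ T, ∀ x,
          ν * ‖gradient (fun y => Real.log (G t y)) x‖ ^ 2 +
              α * timeDerivWithin (Ico t₀ T) (fun s y => Real.log (G s y)) t x ≤ K / (T - t)) →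
        ∀ t ∈ Ico t₀ T, ∀ x,
          c₁ * (T - t) ^ (-(3:ℝ) / 2) * Real.exp (-(‖x - x₀‖ ^ 2) / (c₂ * (T - t))) ≤ G t x)
    (h4 : ∀ (ν C : ℝ), 0 < ν → 0 ≤ C → ∃ C₁ C₂ : ℝ, 0 < C₁ ∧ 0 < C₂ ∧
      ∀ (t₀ T : ℝ) (b : ℝ → EuclideanSpace ℝ (Fin 3) → EuclideanSpace ℝ (Fin 3))
        (x₀ : EuclideanSpace ℝ (Fin 3)) (G : ℝ → EuclideanSpace ℝ (Fin 3) → ℝ), t₀ < T →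
        IsSmoothSpaceTimeOn (Ico t₀ T) b →
        (∀ t ∈ Ico t₀ T, VectorCalculus.IsDivFree (b t)) →
        (∀ t ∈ Ico t₀ T, ∀ x, ‖b t x‖ ≤ C / Real.sqrt (T - t)) →
        IsAdaptedBackwardKernel ν b (Ico t₀ T) T x₀ G →
        (∃ A a : ℝ, 0 < a ∧ ∀ t ∈ Ico t₀ T, ∀ x,
          G t x ≤ A * (T - t) ^ (-(3:ℝ) / 2) * Real.exp (-(‖x - x₀‖ ^ 2) / (a * (T - t)))) →
        ∀ t ∈ Ico t₀ T, ∀ x,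
          G t x ≤ C₁ * (T - t) ^ (-(3:ℝ) / 2) * Real.exp (-(‖x - x₀‖ ^ 2) / (C₂ * (T - t))))
    (h5 : ∀ (ν t₂ t₃ T' T : ℝ) (b : ℝ → EuclideanSpace ℝ (Fin 3) → EuclideanSpace ℝ (Fin 3))
      (x₀ : EuclideanSpace ℝ (Fin 3)), 0 < ν → t₂ < t₃ → t₃ < T' → T' < T →
      IsSmoothSpaceTimeOn (Ioo t₂ T) b →
      (∀ t ∈ Ioo t₂ T, VectorCalculus.IsDivFree (b t)) →
      (∃ B : ℝ, ∀ t ∈ Ioo t₂ T, t ≤ T' → ∀ x, ‖b t x‖ ≤ B ∧ ‖fderiv ℝ (b t) x‖ ≤ B ∧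
          ‖timeDerivWithin (Ioo t₂ T) b t x‖ ≤ B) →
      ∃ G : ℝ → EuclideanSpace ℝ (Fin 3) → ℝ,
        IsAdaptedBackwardKernel ν b (Ico t₃ T') T' x₀ G ∧ IsSmoothSpaceTimeOn (Ico t₃ T') G ∧
        ∃ A a : ℝ, 0 < a ∧ ∀ t ∈ Ico t₃ T', ∀ x,
          G t x ≤ A * (T' - t) ^ (-(3:ℝ) / 2) * Real.exp (-(‖x - x₀‖ ^ 2) / (a * (T' - t))))
    (h6 : ∀ (ν t₃ t₀ T : ℝ) (b : ℝ → EuclideanSpace ℝ (Fin 3) → EuclideanSpace ℝ (Fin 3))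
      (x₀ : EuclideanSpace ℝ (Fin 3)) (c₁ c₂ C₁ C₂ : ℝ), 0 < ν → t₃ < t₀ → t₀ < T →
      0 < c₁ → 0 < c₂ → 0 < C₁ → 0 < C₂ →
      IsSmoothSpaceTimeOn (Ioo t₃ T) b →
      (∀ T' ∈ Ioo t₀ T, ∃ G' : ℝ → EuclideanSpace ℝ (Fin 3) → ℝ,
        IsAdaptedBackwardKernel ν b (Ico t₃ T') T' x₀ G' ∧ IsSmoothSpaceTimeOn (Ico t₃ T') G' ∧
        ∀ t ∈ Ico t₃ T', ∀ x,
          c₁ * (T' - t) ^ (-(3:ℝ) / 2) * Real.exp (-(‖x - x₀‖ ^ 2) / (c₂ * (T' - t))) ≤ G' t x ∧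
          G' t x ≤ C₁ * (T' - t) ^ (-(3:ℝ) / 2) * Real.exp (-(‖x - x₀‖ ^ 2) / (C₂ * (T' - t)))) →
      ∃ G : ℝ → EuclideanSpace ℝ (Fin 3) → ℝ,
        IsAdaptedBackwardKernel ν b (Ico t₀ T) T x₀ G ∧
        ∀ t ∈ Ico t₀ T, ∀ x,
          c₁ * (T - t) ^ (-(3:ℝ) / 2) * Real.exp (-(‖x - x₀‖ ^ 2) / (c₂ * (T - t))) ≤ G t x ∧
          G t x ≤ C₁ * (T - t) ^ (-(3:ℝ) / 2) * Real.exp (-(‖x - x₀‖ ^ 2) / (C₂ * (T - t)))) :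
    ∀ (ν C C' C'' : ℝ), 0 < ν → 0 ≤ C → 0 ≤ C' → 0 ≤ C'' →
      ∃ c₁ c₂ C₁ C₂ : ℝ, 0 < c₁ ∧ 0 < c₂ ∧ 0 < C₁ ∧ 0 < C₂ ∧
      ∀ (t₁ T : ℝ) (b : ℝ → EuclideanSpace ℝ (Fin 3) → EuclideanSpace ℝ (Fin 3))
        (x₀ : EuclideanSpace ℝ (Fin 3)), t₁ < T →
        IsSmoothSpaceTimeOn (Ioo t₁ T) b →
        (∀ t ∈ Ioo t₁ T, VectorCalculus.IsDivFree (b t)) →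
        (∀ t ∈ Ioo t₁ T, ∀ x, ‖b t x‖ ≤ C / Real.sqrt (T - t) ∧ ‖fderiv ℝ (b t) x‖ ≤ C' / (T - t) ∧
            ‖timeDerivWithin (Ioo t₁ T) b t x‖ ≤ C'' / (T - t) ^ ((3:ℝ) / 2)) →
        ∀ t₀ ∈ Ioo t₁ T, ∃ G : ℝ → EuclideanSpace ℝ (Fin 3) → ℝ,
          IsAdaptedBackwardKernel ν b (Ico t₀ T) T x₀ G ∧
          ∀ t ∈ Ico t₀ T, ∀ x,
            c₁ * (T - t) ^ (-(3:ℝ) / 2) * Real.exp (-(‖x - x₀‖ ^ 2) / (c₂ * (T - t))) ≤ G t x ∧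
            G t x ≤ C₁ * (T - t) ^ (-(3:ℝ) / 2) * Real.exp (-(‖x - x₀‖ ^ 2) / (C₂ * (T - t))) := by
  intro ν C C' C'' hν hC hC' hC''
  -- constants of the lever, the lower and the upper bound (α = 2); they depend on (ν, C, C′, C″) only
  obtain ⟨K, hK0, hK⟩ := h2 ν C C' C'' 2 hν hC hC' hC'' (by norm_num)
  obtain ⟨c₁, c₂, hc₁, hc₂, hlow⟩ := h3 ν C K 2 hν hC hK0 (by norm_num)
  obtain ⟨C₁, C₂, hC₁, hC₂, hup⟩ := h4 ν C hν hC
  refine ⟨c₁, c₂, C₁, C₂, hc₁, hc₂, hC₁, hC₂, ?_⟩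
  intro t₁ T b x₀ ht₁T hsm hdiv hpk t₀ ht₀
  -- window placement: the truncated kernels live on `[t₃, T′)` with `t₁ < t₃ < t₀`
  set t₃ : ℝ := (t₁ + t₀) / 2 with ht₃_def
  have h13 : t₁ < t₃ := by rw [ht₃_def]; linarith [ht₀.1]
  have h30 : t₃ < t₀ := by rw [ht₃_def]; linarith [ht₀.1]
  have h0T : t₀ < T := ht₀.2
  have hIoo3 : Ioo t₃ T ⊆ Ioo t₁ T := fun t ht => ⟨h13.trans ht.1, ht.2⟩
  -- kernels on the truncated windows `[t₃, T′)`, `T′ ∈ (t₀, T)`, with UNIFORM two-sided bounds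
  have hker : ∀ T' ∈ Ioo t₀ T, ∃ G' : ℝ → EuclideanSpace ℝ (Fin 3) → ℝ,
      IsAdaptedBackwardKernel ν b (Ico t₃ T') T' x₀ G' ∧ IsSmoothSpaceTimeOn (Ico t₃ T') G' ∧
      ∀ t ∈ Ico t₃ T', ∀ x,
        c₁ * (T' - t) ^ (-(3:ℝ) / 2) * Real.exp (-(‖x - x₀‖ ^ 2) / (c₂ * (T' - t))) ≤ G' t x ∧
        G' t x ≤ C₁ * (T' - t) ^ (-(3:ℝ) / 2) * Real.exp (-(‖x - x₀‖ ^ 2) / (C₂ * (T' - t))) := by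
    intro T' hT'
    have h3T' : t₃ < T' := h30.trans hT'.1
    have hT'T : T' < T := hT'.2
    have hIco3 : Ico t₃ T' ⊆ Ioo t₁ T := fun t ht => ⟨h13.trans_le ht.1, ht.2.trans hT'T⟩
    -- STUB 5: the truncated kernel (the package gives uniform bounds on `(t₁, T′]`)
    have hbd : ∃ B : ℝ, ∀ t ∈ Ioo t₁ T, t ≤ T' → ∀ x, ‖b t x‖ ≤ B ∧ ‖fderiv ℝ (b t) x‖ ≤ B ∧
        ‖timeDerivWithin (Ioo t₁ T) b t x‖ ≤ B := by
      refine ⟨max (C / Real.sqrt (T - T')) (max (C' / (T - T')) (C'' / (T - T') ^ ((3:ℝ) / 2))),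
        fun t ht htT' x => ?_⟩
      obtain ⟨hs, hg, hτ⟩ := hpk t ht x
      have hTT' : 0 < T - T' := sub_pos.2 hT'T
      have hle : T - T' ≤ T - t := by linarith
      refine ⟨?_, ?_, ?_⟩
      · refine le_trans (hs.trans ?_) (le_max_left _ _)
        exact div_le_div_of_nonneg_left hC (Real.sqrt_pos.2 hTT') (Real.sqrt_le_sqrt hle)
      · refine le_trans (hg.trans ?_) ((le_max_left _ _).trans (le_max_right _ _))
        exact div_le_div_of_nonneg_left hC' hTT' hle
      · refine le_trans (hτ.trans ?_) ((le_max_right _ _).trans (le_max_right _ _))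
        exact div_le_div_of_nonneg_left hC'' (Real.rpow_pos_of_pos hTT' _)
          (Real.rpow_le_rpow hTT'.le hle (by norm_num))
    obtain ⟨G', hG', hG'sm, hG'env⟩ := h5 ν t₁ t₃ T' T b x₀ hν h13 h3T' hT'T hsm hdiv hbd
    -- the Type-I package relative to the pole time `T′` on `[t₃, T′)` (same constants)
    have hbI : IsSmoothSpaceTimeOn (Ico t₃ T') b := hsm.mono hIco3
    have hdivI : ∀ t ∈ Ico t₃ T', VectorCalculus.IsDivFree (b t) := fun t ht => hdiv t (hIco3 ht)
    have hsup : ∀ t ∈ Ico t₃ T', ∀ x, ‖b t x‖ ≤ C / Real.sqrt (T' - t) := fun t ht x =>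
      (hpk t (hIco3 ht) x).1.trans (typeI_sup_mono hC ht.2 hT'T.le)
    have hgrad : ∀ t ∈ Ico t₃ T', ∀ x, ‖fderiv ℝ (b t) x‖ ≤ C' / (T' - t) := fun t ht x =>
      (hpk t (hIco3 ht) x).2.1.trans (typeI_grad_mono hC' ht.2 hT'T.le)
    have htime : ∀ t ∈ Ico t₃ T', ∀ x,
        ‖timeDerivWithin (Ico t₃ T') b t x‖ ≤ C'' / (T' - t) ^ ((3:ℝ) / 2) := by
      intro t ht x
      rw [hsm.timeDerivWithin_eq_of_subset hIco3 (uniqueDiffOn_Ico t₃ T') ht x]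
      exact (hpk t (hIco3 ht) x).2.2.trans (typeI_time_mono hC'' ht.2 hT'T.le)
    -- STUB 2 (the lever), then STUBS 3 and 4
    have hH := hK t₃ T' b x₀ G' h3T' hbI hsup hgrad htime hG' hG'sm
    refine ⟨G', hG', hG'sm, fun t ht x => ⟨?_, ?_⟩⟩
    · exact hlow t₃ T' b x₀ G' h3T' hbI hdivI hsup hG' hH t ht x
    · exact hup t₃ T' b x₀ G' h3T' hbI hdivI hsup hG' hG'env t ht x
  -- STUB 6: the limit kernel on `[t₀, T)`
  exact h6 ν t₃ t₀ T b x₀ c₁ c₂ C₁ C₂ hν h30 h0T hc₁ hc₂ hC₁ hC₂ (hsm.mono hIoo3) hker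

/-- **The transfer `C⁺⁺ → crux`, modulo the Navier–Stokes input STUB 1 (sorry-free).** The classical solution's
velocity is smooth and divergence free on `(t₁, T)`, STUB 1 gives the Type-I package there (its one-sided time
derivative within `[0,T)` agrees with the one within `(t₁,T)`), and `C⁺⁺` applied with `t₀ = (t₁+T)/2` gives
the kernel; `isAdaptedBackwardKernel_iff` unfolds the kernel notion to the crux's five inline clauses. -/
theorem adaptedKernelExists_of_linear
    (h1 : ∀ (ν T : ℝ), 0 < ν → 0 < T →
      ∀ (u : ℝ → EuclideanSpace ℝ (Fin 3) → EuclideanSpace ℝ (Fin 3))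
        (p : ℝ → EuclideanSpace ℝ (Fin 3) → ℝ),
        IsClassicalNSSolutionOn (Ico 0 T) ν 0 u p → IsLerayHopfOn T ν 0 (u 0) u →
        HasRapidSpatialDecay (u 0) → IsTypeIBlowup u T →
        ∃ t₁ ∈ Ico 0 T, ∃ C C' C'' : ℝ, 0 ≤ C ∧ 0 ≤ C' ∧ 0 ≤ C'' ∧
          ∀ t ∈ Ico t₁ T, ∀ x,
            ‖u t x‖ ≤ C / Real.sqrt (T - t) ∧
            ‖fderiv ℝ (u t) x‖ ≤ C' / (T - t) ∧
            ‖timeDerivWithin (Ico 0 T) u t x‖ ≤ C'' / (T - t) ^ ((3:ℝ) / 2))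
    (hL : ∀ (ν C C' C'' : ℝ), 0 < ν → 0 ≤ C → 0 ≤ C' → 0 ≤ C'' →
      ∃ c₁ c₂ C₁ C₂ : ℝ, 0 < c₁ ∧ 0 < c₂ ∧ 0 < C₁ ∧ 0 < C₂ ∧
      ∀ (t₁ T : ℝ) (b : ℝ → EuclideanSpace ℝ (Fin 3) → EuclideanSpace ℝ (Fin 3))
        (x₀ : EuclideanSpace ℝ (Fin 3)), t₁ < T →
        IsSmoothSpaceTimeOn (Ioo t₁ T) b →
        (∀ t ∈ Ioo t₁ T, VectorCalculus.IsDivFree (b t)) →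
        (∀ t ∈ Ioo t₁ T, ∀ x, ‖b t x‖ ≤ C / Real.sqrt (T - t) ∧ ‖fderiv ℝ (b t) x‖ ≤ C' / (T - t) ∧
            ‖timeDerivWithin (Ioo t₁ T) b t x‖ ≤ C'' / (T - t) ^ ((3:ℝ) / 2)) →
        ∀ t₀ ∈ Ioo t₁ T, ∃ G : ℝ → EuclideanSpace ℝ (Fin 3) → ℝ,
          IsAdaptedBackwardKernel ν b (Ico t₀ T) T x₀ G ∧
          ∀ t ∈ Ico t₀ T, ∀ x,
            c₁ * (T - t) ^ (-(3:ℝ) / 2) * Real.exp (-(‖x - x₀‖ ^ 2) / (c₂ * (T - t))) ≤ G t x ∧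
            G t x ≤ C₁ * (T - t) ^ (-(3:ℝ) / 2) * Real.exp (-(‖x - x₀‖ ^ 2) / (C₂ * (T - t)))) :
    ∀ (ν T : ℝ), 0 < ν → 0 < T → ∀ (u : ℝ → EuclideanSpace ℝ (Fin 3) → EuclideanSpace ℝ (Fin 3))
      (p : ℝ → EuclideanSpace ℝ (Fin 3) → ℝ),
      Literature.Analysis.FluidPDE.IsClassicalNSSolutionOn (Set.Ico 0 T) ν 0 u p →
      Literature.Analysis.FluidPDE.IsLerayHopfOn T ν 0 (u 0) u →
      Literature.Analysis.FluidPDE.HasRapidSpatialDecay (u 0) →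
      Literature.Analysis.FluidPDE.IsTypeIBlowup u T → ∀ x₀ : EuclideanSpace ℝ (Fin 3),
      ∃ t₀ ∈ Set.Ico 0 T, ∃ G : ℝ → EuclideanSpace ℝ (Fin 3) → ℝ,
        (ContDiffOn ℝ 2 (Function.uncurry G) (Set.Ico t₀ T ×ˢ Set.univ) ∧
          (∀ t ∈ Set.Ico t₀ T, ∀ x, 0 < G t x) ∧
          (∀ t ∈ Set.Ico t₀ T, ∀ x,
            Literature.Analysis.FluidPDE.timeDerivWithin (Set.Ico t₀ T) G t x + fderiv ℝ (G t) x (u t x) +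
              ν * Laplacian.laplacian (G t) x = 0) ∧
          (∀ t ∈ Set.Ico t₀ T, ∫ x, G t x = 1) ∧
          (∀ φ : EuclideanSpace ℝ (Fin 3) → ℝ, Continuous φ → (∃ M : ℝ, ∀ x, |φ x| ≤ M) →
            Filter.Tendsto (fun t => ∫ x, φ x * G t x) (nhdsWithin T (Set.Iio T)) (nhds (φ x₀)))) ∧
        (∃ c₁ c₂ C₁ C₂ : ℝ, 0 < c₁ ∧ 0 < c₂ ∧ 0 < C₁ ∧ 0 < C₂ ∧ ∀ t ∈ Set.Ico t₀ T, ∀ x,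
          c₁ * (T - t) ^ (-(3:ℝ) / 2) * Real.exp (-(‖x - x₀‖ ^ 2) / (c₂ * (T - t))) ≤ G t x ∧
          G t x ≤ C₁ * (T - t) ^ (-(3:ℝ) / 2) * Real.exp (-(‖x - x₀‖ ^ 2) / (C₂ * (T - t)))) := by
  intro ν T hν hT u p hcl hLH hdec hTI x₀
  -- STUB 1: the Type-I package on `[t₁, T)`
  obtain ⟨t₁, ht₁, C, C', C'', hC, hC', hC'', hpk⟩ := h1 ν T hν hT u p hcl hLH hdec hTI
  obtain ⟨c₁, c₂, C₁, C₂, hc₁, hc₂, hC₁, hC₂, hlin⟩ := hL ν C C' C'' hν hC hC' hC''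
  have hsm : IsSmoothSpaceTimeOn (Ico 0 T) u := hcl.smooth_velocity
  have hIoo1 : Ioo t₁ T ⊆ Ico 0 T := fun t ht => ⟨ht₁.1.trans ht.1.le, ht.2⟩
  -- the package on the open window `(t₁, T)` (one-sided derivative within `[0,T)` = two-sided)
  have hpk' : ∀ t ∈ Ioo t₁ T, ∀ x, ‖u t x‖ ≤ C / Real.sqrt (T - t) ∧
      ‖fderiv ℝ (u t) x‖ ≤ C' / (T - t) ∧
      ‖timeDerivWithin (Ioo t₁ T) u t x‖ ≤ C'' / (T - t) ^ ((3:ℝ) / 2) := by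
    intro t ht x
    obtain ⟨hs, hg, hτ⟩ := hpk t ⟨ht.1.le, ht.2⟩ x
    refine ⟨hs, hg, ?_⟩
    rw [hsm.timeDerivWithin_eq_of_subset hIoo1 (uniqueDiffOn_Ioo t₁ T) ht x]
    exact hτ
  set t₀ : ℝ := (t₁ + T) / 2 with ht₀_def
  have ht₀ : t₀ ∈ Ioo t₁ T := ⟨by rw [ht₀_def]; linarith [ht₁.2], by rw [ht₀_def]; linarith [ht₁.2]⟩
  obtain ⟨G, hG, hGb⟩ := hlin t₁ T u x₀ ht₁.2 (hsm.mono hIoo1) (fun t ht => hcl.divFree t (hIoo1 ht))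
    hpk' t₀ ht₀
  exact ⟨t₀, ⟨ht₁.1.trans ht₀.1.le, ht₀.2⟩, G, (isAdaptedBackwardKernel_iff).1 hG,
    c₁, c₂, C₁, C₂, hc₁, hc₂, hC₁, hC₂, hGb⟩

open Summit.NavierStokesRegularity.NavierStokesRegularity.Theses.AdaptedFrequency (AdaptedKernelExists)

/-- **THE SKELETON THEOREM**: concludes the crux
`Summit.NavierStokesRegularity.NavierStokesRegularity.Theses.AdaptedFrequency.AdaptedKernelExists` BY NAME from the
six registered stubs — STUB 1 (NS input) and the transfer target `C⁺⁺` assembled from STUBS 2–6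
(`linearKernel_of_stubs`); the only `sorry`s of this file sit inside the `stub_*` theorems. -/
theorem AdaptedKernelExists_of : AdaptedKernelExists :=
  adaptedKernelExists_of_linear stub_typeOnePackage
    (linearKernel_of_stubs stub_liYauHarnack stub_harnackLowerBound stub_gaussianUpperBound
      stub_truncatedKernel stub_limitKernel)

end Summit.NavierStokesRegularity.NavierStokesRegularity.Cruxes.AdaptedKernelExists.LiYauType1Curvature
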